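import Summits.CriticalPhenomena.PercolationContinuityZ3.Theorems.PercNearOneGluingNoHeavyQuantGateMoveBlobCells
import Summits.CriticalPhenomena.PercolationContinuityZ3.Theorems.PercNearOneGluingNoHeavyQuantTwinMove
import Summits.CriticalPhenomena.PercolationContinuityZ3.Theorems.PercNearOneGluingNoHeavyQuantTwoBlobTopFlippedHeavy
import Summits.CriticalPhenomena.PercolationContinuityZ3.Theorems.PercNearOneGluingNoHeavyQuantWindowMix
import HarnessLib

/-!
# QUANT lane R8, T-DEC, leg (III): the blob gate move / window form CW from a HEAVY datum of the partner at ONE layer whose zero rides giants —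
# **`decAtT_gateMoveBlob_of_heavyDatum`** (generalises this seat's criterion-E branch `decAtT_gateMoveBlob_of_critE` to data with heavy MID pairs)

builds on p205010 (kernel theorem, internal audit signed; external expert review pending)

Support file (`--supports stmt-CriticalPhenomena-4575`), QUANT lane seat prim-quant-arm-1 (gen 40), rung R8 of
`run/shared/lean/prim/quant/LADDER.md`.  Theorems only (no definitions), standard axioms, no sorries.  Memo
`run/shared/lean/prim/quant/prim-quant-arm-1-g40/CW-PRIMAL-G40.md` §7.

THE STATEMENT.  `0 < y < 1`, `0 ≤ z`, `y ≤ g ≤ 1`, `1 ≤ a`; `ν = Σ_r λ_r·{lo_r, hi_r; γ_r}` an explicit DEC datum at `(y, S, j, M)` (weights `λ ≥ 0`,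
`Σ λ = 1`, `hi_r ≤ M`, every charged component `ValidAt y S j`) which is HEAVY (`γ_r ≥ y` on every charged genuine pair — automatic for giant pairs) and whose ZERO
rides giants enough: `z ≤ Σ_{r : lo_r = 0, hi_r > j} λ_r (1 − γ_r)` (the zero mass paired with giants covers the moved mass).  THEN the moved slice
`slice ν a g + g z (δ₀ − δ_a)` is `DECAtT y (S + ag − zag) j (M + a)` — the conclusion of the move lemma (M) / of `LawDec.WindowMixDEC` at the layer `j`
from the layer `j` ALONE.  No top-affordability, no regime; `j`, `a` arbitrary.  The criterion-E branch (`…QuantGateMoveBlobGiantData`) is the case in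
which every low rides giants; here the NONZERO lows may ride heavy credit pairs into mids.
PROOF (component-wise; `decAtT_mixture_finset`, lead g30): distribute the moved mass `g z` over the zero's GIANT components proportionally
(`m_r = z·λ_r(1−γ_r)/Z_G`), so that `P = Σ_r λ_r·Q_r` with `Q_r = slice{lo_r, hi_r; γ_r} a g + g (m_r/λ_r)(δ₀ − δ_a)` (`slice_sum_TP`); then at the
common `(y, t, j)`: a point `{k}` becomes the pair `{k, k+a; g}` (giant, or credit `2k + ag ≥ S + ag ≥ t`); a heavy credit pair stays DEC after slicing
at every target `≤ 2lo + (hi−lo)γ + ag` (typer g23's `slice_heavyPair_decAtT_allLayers`, from BLOB-DEC(2)) and `t ≤ S + ag ≤` that; a giant pair — moved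
or not — keeps giant mass `γ_r ≥ y` at `hi_r, hi_r + a` and is DEC at every target by the E-regime (`decAtT_of_giantMass_ge`).
EXACT PRE-CHECKS (seat engines, `work/explore/cw_heavy*.py`): every window-edge instance admitting a heavy layer-`j` datum has `P` DEC (14 633 / 0,
`y` bisected to the edge of heavy feasibility); the component route with the zero's move on its giant components certifies every component of every
instance whose heavy datum puts the moved mass on zero–giant pairs (2 887 instances; the only failing component type in the complement is the MOVED
zero–MID cell, 226 cells in 188 instances — there the components must cross-subsidise, and that sub-case is NOT claimed here).

* `LawDec.decAtT_TP_twin` — the sliced point: `{k, k+a; g}` is DEC at `(y, t, j)` when `2k + ag ≥ t` or `k > j` (`y ≤ g`).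
* `LawDec.decAtT_movedGiantPair` — the (moved) slice of a giant pair `{lo, hi; γ ≥ y}`, `hi > j`, is DEC at every target.
* **`LawDec.decAtT_gateMoveBlob_of_heavyDatum`** — the theorem;  **`LawDec.windowMix_of_heavyDatum`** — the same in `WindowMixDEC`'s binder.

HONEST STATUS: the LIGHT-pair / zero-on-mids branch of CW (`WindowMixDEC`) remains OPEN (it needs the window: census-2's `slCex`); `WindowMixSingleLayer`,
`GateMove`, `GatedConvEmptyFree`, `SingleGateConvClosed`, `TreeDEC`, `FarTreeRow` OPEN; RATE class log\* / honest sentence UNCHANGED.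

[this work]; BLOB-DEC(2) slice lemma: prim-quant-stmt g22–g23; mixtures / `slice_sum_TP`: prim-quant-lead g30; `WindowMixDEC`: lead g31 (this lane).
Nothing here is cited as a published result.  The gluing rows served [cite: KozmaNitzan2024, Conjecture 3 (p. 15)]; product measure
[cite: Grimmett1999, §1.3 p. 10].
-/

noncomputable section

namespace Summit.CriticalPhenomena.PercolationContinuityZ3.Theorems

namespace Quant

open Finset

/-- the two-point law `{lo, hi; g}` (as in `…QuantLawDEC`) -/
local notation3 "TP[" lo ", " hi ", " g ", " h "]" =>
  (g : ℝ) * (if (h : ℕ) = (hi : ℕ) then (1 : ℝ) else 0) + (1 - (g : ℝ)) * (if (h : ℕ) = (lo : ℕ) then (1 : ℝ) else 0)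

namespace LawDec

/-! ### The components -/

/-- **a sliced point**: the pair law `{k, k+a; g}` is `DECAtT y t j N` when `y ≤ g ≤ 1`, `0 ≤ g`, `1 ≤ a`, `k + a ≤ N`, and either `k + a > j`
(giant pair) or `t ≤ 2k + ag` (credit pair). [this work] -/
theorem decAtT_TP_twin (y t g : ℝ) (j N k a : ℕ) (hg0 : 0 ≤ g) (hg1 : g ≤ 1) (hyg : y ≤ g) (ha : 1 ≤ a) (hkN : k + a ≤ N)
    (hcase : j + 1 ≤ k + a ∨ t ≤ 2 * (k : ℝ) + (a : ℝ) * g) :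
    DECAtT y t j N (fun h => TP[k, k + a, g, h]) := by
  refine ⟨Unit, inferInstance, fun _ => 1, fun _ => g, fun _ => k, fun _ => k + a, fun _ => zero_le_one, by simp,
    fun _ => ⟨hg0, hg1⟩, fun _ => Nat.le_add_right k a, fun _ => hkN, fun h => by simp, fun _ _ => ?_⟩
  show ValidAt y t j k (k + a) g
  have hlt : k < k + a := by omega
  rcases hcase with hgi | hcr
  · exact Or.inr (Or.inl ⟨hlt, hgi, hyg⟩)
  · by_cases hgi : j + 1 ≤ k + a
    · exact Or.inr (Or.inl ⟨hlt, hgi, hyg⟩)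
    · refine Or.inr (Or.inr ⟨hlt, by omega, ?_⟩)
      rw [if_pos hyg]; push_cast; linarith

/-- **the (moved) slice of a GIANT pair is DEC at every target.**  `0 < y < 1`, `0 ≤ g ≤ 1`, `1 ≤ a`, `lo < hi ≤ M`, `j + 1 ≤ hi`, `y ≤ γ ≤ 1`,
`0 ≤ m ≤ [lo = 0]·(1 − γ)`: the law `slice {lo, hi; γ} a g + g m (δ₀ − δ_a)` has giant mass `≥ γ ≥ y` at `hi, hi + a` (E-regime). [this work] -/
theorem decAtT_movedGiantPair (y t g γ m : ℝ) (j M lo hi a : ℕ) (hy0 : 0 < y) (hy1 : y < 1) (hg0 : 0 ≤ g) (hg1 : g ≤ 1) (ha : 1 ≤ a)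
    (hlt : lo < hi) (hhi : hi ≤ M) (hgi : j + 1 ≤ hi) (hyγ : y ≤ γ) (hγ1 : γ ≤ 1) (hm0 : 0 ≤ m)
    (hm : m ≤ (if lo = 0 then 1 - γ else 0)) :
    DECAtT y t j (M + a)
      (fun h => slice (fun k => TP[lo, hi, γ, k]) a g h + g * m * ((if h = 0 then (1 : ℝ) else 0) - (if h = a then (1 : ℝ) else 0))) := by
  have hγ0 : 0 ≤ γ := hy0.le.trans hyγ
  have hTP0 : ∀ k, 0 ≤ TP[lo, hi, γ, k] := fun k =>
    add_nonneg (mul_nonneg hγ0 (by split_ifs <;> norm_num)) (mul_nonneg (by linarith) (by split_ifs <;> norm_num))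
  have hTPM : ∀ k, M < k → TP[lo, hi, γ, k] = 0 := fun k hk => by
    rw [if_neg (by omega), if_neg (by omega)]; ring
  have hTP1 : ∑ k ∈ Finset.range (M + 1), TP[lo, hi, γ, k] = 1 := sum_TP_range M lo hi γ (by omega) hhi
  have hmν : m ≤ TP[lo, hi, γ, 0] := by
    by_cases hl0 : lo = 0
    · rw [if_pos hl0] at hm
      have : (1 - γ) * (if (0 : ℕ) = lo then (1 : ℝ) else 0) = 1 - γ := by rw [if_pos hl0.symm, mul_one]
      have h2 : 0 ≤ γ * (if (0 : ℕ) = hi then (1 : ℝ) else 0) := mul_nonneg hγ0 (by split_ifs <;> norm_num)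
      linarith
    · rw [if_neg hl0] at hm
      exact hm.trans (hTP0 0)
  obtain ⟨q0, qM, q1, -⟩ := moved_laws (fun k => TP[lo, hi, γ, k]) a M g m ha hg0 hg1 hm0 hmν hTP0 hTPM hTP1
  refine decAtT_of_giantMass_ge y t j (M + a) _ hy0 hy1 q0 qM q1 ?_
  -- giant mass ≥ the two copies of `hi`
  have hsub : ({hi, hi + a} : Finset ℕ) ⊆ Finset.Ico (j + 1) (M + a + 1) := by
    intro p hp
    rw [Finset.mem_insert, Finset.mem_singleton] at hp
    rw [Finset.mem_Ico]; omega
  have hne : hi ≠ hi + a := by omega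
  refine le_trans ?_ (Finset.sum_le_sum_of_subset_of_nonneg hsub (fun p _ _ => q0 p))
  rw [Finset.sum_pair hne]
  -- the copy at `hi`
  have h1 : (1 - g) * γ ≤ slice (fun k => TP[lo, hi, γ, k]) a g hi
      + g * m * ((if hi = 0 then (1 : ℝ) else 0) - (if hi = a then (1 : ℝ) else 0)) := by
    have h0 : hi ≠ 0 := by omega
    rw [if_neg h0]
    rw [show slice (fun k => TP[lo, hi, γ, k]) a g hi
        = (1 - g) * TP[lo, hi, γ, hi] + g * (if a ≤ hi then TP[lo, hi, γ, hi - a] else 0) from rfl]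
    rw [if_pos rfl, if_neg (ne_of_gt hlt)]
    by_cases hha : hi = a
    · rw [if_pos hha, if_pos (le_of_eq hha.symm), show hi - a = 0 by omega]
      nlinarith [hmν, hTP0 0, mul_nonneg hg0 (sub_nonneg.2 hmν)]
    · rw [if_neg hha]
      have : 0 ≤ g * (if a ≤ hi then TP[lo, hi, γ, hi - a] else 0) := by
        refine mul_nonneg hg0 ?_
        by_cases hah : a ≤ hi
        · rw [if_pos hah]; exact hTP0 _
        · rw [if_neg hah]
      nlinarith
  -- the copy at `hi + a`
  have h2 : g * γ ≤ slice (fun k => TP[lo, hi, γ, k]) a g (hi + a)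
      + g * m * ((if hi + a = 0 then (1 : ℝ) else 0) - (if hi + a = a then (1 : ℝ) else 0)) := by
    rw [if_neg (by omega : hi + a ≠ 0), if_neg (by omega : hi + a ≠ a)]
    rw [show slice (fun k => TP[lo, hi, γ, k]) a g (hi + a)
        = (1 - g) * TP[lo, hi, γ, hi + a] + g * (if a ≤ hi + a then TP[lo, hi, γ, hi + a - a] else 0) from rfl]
    rw [if_pos (Nat.le_add_left a hi), Nat.add_sub_cancel, if_pos rfl, if_neg (ne_of_gt hlt)]
    have : 0 ≤ (1 - g) * TP[lo, hi, γ, hi + a] := mul_nonneg (by linarith) (hTP0 _)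
    nlinarith
  linarith

/-! ### The theorem -/

/-- **THE BLOB GATE MOVE FROM A HEAVY DATUM OF THE PARTNER AT ONE LAYER WHOSE ZERO RIDES GIANTS.**  See the module docstring. [this work] -/
theorem decAtT_gateMoveBlob_of_heavyDatum {ρ : Type} [Fintype ρ] (y z g S : ℝ) (a j M : ℕ) (ν : ℕ → ℝ)
    (lam gg : ρ → ℝ) (lo hi : ρ → ℕ)
    (hy0 : 0 < y) (hy1 : y < 1) (hz0 : 0 ≤ z) (hg1 : g ≤ 1) (hyg : y ≤ g) (ha : 1 ≤ a)
    (h0 : ∀ r, 0 ≤ lam r) (h1 : ∑ r, lam r = 1) (hgg : ∀ r, 0 ≤ gg r ∧ gg r ≤ 1) (hhi : ∀ r, hi r ≤ M)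
    (hν : ∀ h, ν h = ∑ r, lam r * TP[lo r, hi r, gg r, h])
    (hval : ∀ r, 0 < lam r → ValidAt y S j (lo r) (hi r) (gg r))
    (hheavy : ∀ r, 0 < lam r → lo r < hi r → hi r ≤ j → y ≤ gg r)
    (hzero : z ≤ ∑ r, (if lo r = 0 ∧ j + 1 ≤ hi r then lam r * (1 - gg r) else 0)) :
    DECAtT y (S + (a : ℝ) * g - z * (a : ℝ) * g) j (M + a)
      (fun h => slice ν a g h + g * z * ((if h = 0 then (1 : ℝ) else 0) - (if h = a then (1 : ℝ) else 0))) := by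
  classical
  have hg0 : 0 ≤ g := hy0.le.trans hyg
  have ha0 : (0 : ℝ) < a := by exact_mod_cast (Nat.lt_of_lt_of_le Nat.zero_lt_one ha)
  set t : ℝ := S + (a : ℝ) * g - z * (a : ℝ) * g with ht
  have hta : t ≤ S + (a : ℝ) * g := by rw [ht]; nlinarith [mul_nonneg ha0.le hg0]
  set ZG : ℝ := ∑ r, (if lo r = 0 ∧ j + 1 ≤ hi r then lam r * (1 - gg r) else 0) with hZG
  have hZG0 : 0 ≤ ZG := Finset.sum_nonneg fun r _ => by
    split_ifs
    · exact mul_nonneg (h0 r) (by linarith [(hgg r).2])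
    · exact le_rfl
  -- the moved masses
  set m : ρ → ℝ := fun r => if ZG = 0 then 0 else (if lo r = 0 ∧ j + 1 ≤ hi r then z * (lam r * (1 - gg r)) / ZG else 0) with hm
  have hm0 : ∀ r, 0 ≤ m r := fun r => by
    simp only [hm]; split_ifs
    · exact le_rfl
    · exact div_nonneg (mul_nonneg hz0 (mul_nonneg (h0 r) (by linarith [(hgg r).2]))) hZG0
    · exact le_rfl
  have hmle : ∀ r, m r ≤ (if lo r = 0 ∧ j + 1 ≤ hi r then lam r * (1 - gg r) else 0) := fun r => by
    simp only [hm]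
    by_cases hZ : ZG = 0
    · rw [if_pos hZ]; split_ifs; exacts [mul_nonneg (h0 r) (by linarith [(hgg r).2]), le_rfl]
    · rw [if_neg hZ]
      have hZpos : 0 < ZG := lt_of_le_of_ne hZG0 (Ne.symm hZ)
      split_ifs with hc
      · rw [div_le_iff₀ hZpos]
        have : z * (lam r * (1 - gg r)) ≤ ZG * (lam r * (1 - gg r)) :=
          mul_le_mul_of_nonneg_right hzero (mul_nonneg (h0 r) (by linarith [(hgg r).2]))
        linarith
      · exact le_rfl
  have hmsum : ∑ r, m r = z := by
    simp only [hm]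
    by_cases hZ : ZG = 0
    · simp only [if_pos hZ, Finset.sum_const_zero]
      have : z ≤ 0 := by rw [← hZ]; exact hzero
      linarith
    · simp only [if_neg hZ]
      have e : ∀ r, (if lo r = 0 ∧ j + 1 ≤ hi r then z * (lam r * (1 - gg r)) / ZG else 0)
          = (z / ZG) * (if lo r = 0 ∧ j + 1 ≤ hi r then lam r * (1 - gg r) else 0) := fun r => by
        split_ifs <;> ring
      rw [Finset.sum_congr rfl (fun r _ => e r), ← Finset.mul_sum, ← hZG, div_mul_cancel₀ _ hZ]
  have hmlam : ∀ r, lam r = 0 → m r = 0 := fun r hr => by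
    have := hmle r; rw [hr] at this
    have h2 : m r ≤ 0 := this.trans (by split_ifs <;> simp)
    exact le_antisymm h2 (hm0 r)
  -- the components
  set Q : ρ → ℕ → ℝ := fun r h => slice (fun k => TP[lo r, hi r, gg r, k]) a g h
      + g * (m r / lam r) * ((if h = 0 then (1 : ℝ) else 0) - (if h = a then (1 : ℝ) else 0)) with hQ
  -- `P = Σ λ_r Q_r`
  have hP : ∀ h, slice ν a g h + g * z * ((if h = 0 then (1 : ℝ) else 0) - (if h = a then (1 : ℝ) else 0))
      = ∑ r, lam r * Q r h := by
    intro h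
    have e1 : slice ν a g h = ∑ r, lam r * slice (fun k => TP[lo r, hi r, gg r, k]) a g h := by
      have : ν = fun k => ∑ r, lam r * TP[lo r, hi r, gg r, k] := funext hν
      rw [this]; exact slice_sum_TP Finset.univ lam gg lo hi a g h
    have e2 : ∀ r, lam r * Q r h = lam r * slice (fun k => TP[lo r, hi r, gg r, k]) a g h
        + g * m r * ((if h = 0 then (1 : ℝ) else 0) - (if h = a then (1 : ℝ) else 0)) := by
      intro r
      simp only [hQ]
      by_cases hl : lam r = 0
      · rw [hl, hmlam r hl]; ring
      · rw [mul_add, show lam r * (g * (m r / lam r) * ((if h = 0 then (1 : ℝ) else 0) - (if h = a then (1 : ℝ) else 0)))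
            = g * (lam r * (m r / lam r)) * ((if h = 0 then (1 : ℝ) else 0) - (if h = a then (1 : ℝ) else 0)) by ring,
          mul_div_cancel₀ _ hl]
    rw [Finset.sum_congr rfl (fun r _ => e2 r), Finset.sum_add_distrib, ← e1]
    have e3 : ∑ r, g * m r * ((if h = 0 then (1 : ℝ) else 0) - (if h = a then (1 : ℝ) else 0))
        = g * (∑ r, m r) * ((if h = 0 then (1 : ℝ) else 0) - (if h = a then (1 : ℝ) else 0)) := by
      rw [Finset.mul_sum, Finset.sum_mul]
    rw [e3, hmsum]
  refine decAtT_congr (fun h => (hP h).symm) ?_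
  refine decAtT_mixture_finset Finset.univ lam Q (fun r _ => h0 r) h1 (fun r _ hr => ?_)
  -- each charged component is DEC at the common `(y, t, j)`
  rcases hval r hr with ⟨heq, hS⟩ | ⟨hlt, hgi, hyγ⟩ | ⟨hlt, hhij, hcr⟩
  · -- a point `k`: the move share vanishes and the slice is the pair `{k, k+a; g}`
    have hmr : m r = 0 := by
      have := hmle r
      have hc : ¬ (lo r = 0 ∧ j + 1 ≤ hi r) := by
        rintro ⟨h0', hj'⟩
        rcases hS with h2 | h2
        · rw [h0'] at h2; simp at h2; linarith
        · omega
      rw [if_neg hc] at this; exact le_antisymm this (hm0 r)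
    have e : Q r = fun h => TP[lo r, lo r + a, g, h] := by
      funext h
      simp only [hQ, hmr, zero_div, mul_zero, zero_mul, add_zero]
      rw [slice_TP, ← heq]
      have : ∀ q p : ℕ, TP[q, q, gg r, p] = (if p = q then (1 : ℝ) else 0) := fun q p => by ring
      rw [this, this]
      ring
    rw [e]
    refine decAtT_TP_twin y t g j (M + a) (lo r) a hg0 hg1 hyg ha (by have := hhi r; omega) ?_
    rcases hS with h2 | h2
    · right; linarith [mul_nonneg ha0.le hg0]
    · left; omega
  · -- a giant pair
    have hmr : m r / lam r ≤ (if lo r = 0 then 1 - gg r else 0) := by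
      rw [div_le_iff₀ hr]
      have := hmle r
      by_cases hl0 : lo r = 0
      · rw [if_pos hl0]; rw [if_pos ⟨hl0, hgi⟩] at this; linarith
      · rw [if_neg hl0, zero_mul]; rw [if_neg (fun hc => hl0 hc.1)] at this; exact this
    exact decAtT_movedGiantPair y t g (gg r) (m r / lam r) j M (lo r) (hi r) a hy0 hy1 hg0 hg1 ha hlt (hhi r) hgi hyγ (hgg r).2
      (div_nonneg (hm0 r) hr.le) hmr
  · -- a heavy credit pair into a mid: no move share; the BLOB-DEC(2) slice lemma
    have hyγ : y ≤ gg r := hheavy r hr hlt hhij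
    have hmr : m r = 0 := by
      have := hmle r
      rw [if_neg (fun hc => by omega)] at this; exact le_antisymm this (hm0 r)
    have e : Q r = slice (fun k => TP[lo r, hi r, gg r, k]) a g := by
      funext h; simp only [hQ, hmr, zero_div, mul_zero, zero_mul, add_zero]
    rw [e]
    rw [if_pos hyγ] at hcr
    exact slice_heavyPair_decAtT_allLayers y t g (gg r) j M (lo r) (hi r) a hy0 hy1 hyg hg1 hyγ (hgg r).2 ha hlt (hhi r) (by linarith)

/-- **the same in the binder of `LawDec.WindowMixDEC`** (conclusion law `(1−g)·ν + g·shiftBut ν a z`, target `S + ag(1−z)`). [this work] -/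
theorem windowMix_of_heavyDatum {ρ : Type} [Fintype ρ] (y z g S : ℝ) (a j M : ℕ) (ν : ℕ → ℝ)
    (lam gg : ρ → ℝ) (lo hi : ρ → ℕ)
    (hy0 : 0 < y) (hy1 : y < 1) (hz0 : 0 ≤ z) (hg1 : g ≤ 1) (hyg : y ≤ g) (ha : 1 ≤ a)
    (h0 : ∀ r, 0 ≤ lam r) (h1 : ∑ r, lam r = 1) (hgg : ∀ r, 0 ≤ gg r ∧ gg r ≤ 1) (hhi : ∀ r, hi r ≤ M)
    (hν : ∀ h, ν h = ∑ r, lam r * TP[lo r, hi r, gg r, h])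
    (hval : ∀ r, 0 < lam r → ValidAt y S j (lo r) (hi r) (gg r))
    (hheavy : ∀ r, 0 < lam r → lo r < hi r → hi r ≤ j → y ≤ gg r)
    (hzero : z ≤ ∑ r, (if lo r = 0 ∧ j + 1 ≤ hi r then lam r * (1 - gg r) else 0)) :
    DECAtT y (S + (a : ℝ) * g * (1 - z)) j (M + a) (fun h => (1 - g) * ν h + g * shiftBut ν a z h) := by
  have e : (fun h => (1 - g) * ν h + g * shiftBut ν a z h)
      = fun h => slice ν a g h + g * z * ((if h = 0 then (1 : ℝ) else 0) - (if h = a then (1 : ℝ) else 0)) :=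
    funext fun h => windowMix_eq_slice_add ν a g z h
  rw [e, show S + (a : ℝ) * g * (1 - z) = S + (a : ℝ) * g - z * (a : ℝ) * g by ring]
  exact decAtT_gateMoveBlob_of_heavyDatum y z g S a j M ν lam gg lo hi hy0 hy1 hz0 hg1 hyg ha h0 h1 hgg hhi hν hval hheavy hzero

end LawDec

end Quant

end Summit.CriticalPhenomena.PercolationContinuityZ3.Theorems
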